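import Summits.QuantumAdvantage.QuantumAdvantage.Theorems.LivenessSeparationLawN

set_option linter.dupNamespace false

/-!
# Liveness separation, part S — the parity (cancellation) lemma of the alignment end game

Lens 4 (minimal counterexample), node `CoSupportDial`, memo S-PRIME §10 (two disjoint adjacent pairs).
XOR a common Boolean function `h` into the registers of a set `P` of cuts (`xorSet`).  At an input `u`
the win bit is unchanged whenever `h u = false` or the number of cuts of `P` that are LIVE at `u` is even
(`ringWinU_xorSet_of_even`): the contributions of `h` to the win parity cancel in pairs.  In the end game
of the two-pairs configuration the uncertified register `y_a` is XOR-ed into the four pair registers,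
the final frozen assignment is chosen so that the live count of the two pairs is even on every class
(part R, `residue_succ_cut`), and the resulting strategy — entirely few-form — has the same win bit
everywhere on the final cube.
-/

namespace Summit.QuantumAdvantage.QuantumAdvantage.Theorems.LivenessSeparation

open Finset Summit.QuantumAdvantage.AdviceFreeQNC0 InnerDegreeDial

variable {n : ℕ}

/-- XOR the common function `h` into every register of the set `P` -/
def xorSet (y : Fin (n + 1) → (Fin n → Bool) → Bool) (P : Finset (Fin (n + 1))) (h : (Fin n → Bool) → Bool) :
    Fin (n + 1) → (Fin n → Bool) → Bool :=
  fun g u => if g ∈ P then xor (y g u) (h u) else y g u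

/-- registers outside `P` are unchanged -/
theorem xorSet_of_not_mem (y : Fin (n + 1) → (Fin n → Bool) → Bool) {P : Finset (Fin (n + 1))} (h : (Fin n → Bool) → Bool)
    {g : Fin (n + 1)} (hg : g ∉ P) (u : Fin n → Bool) : xorSet y P h g u = y g u := by
  simp [xorSet, hg]

/-- registers inside `P` are flipped exactly where `h` fires -/
theorem xorSet_of_mem (y : Fin (n + 1) → (Fin n → Bool) → Bool) {P : Finset (Fin (n + 1))} (h : (Fin n → Bool) → Bool)
    {g : Fin (n + 1)} (hg : g ∈ P) (u : Fin n → Bool) : xorSet y P h g u = xor (y g u) (h u) := by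
  simp [xorSet, hg]

/-- where `h` does not fire nothing changes -/
theorem ringWinU_xorSet_of_false (c : ℕ) (y : Fin (n + 1) → (Fin n → Bool) → Bool) (P : Finset (Fin (n + 1)))
    (h : (Fin n → Bool) → Bool) (u : Fin n → Bool) (hu : h u = false) : ringWinU c (xorSet y P h) u = ringWinU c y u := by
  have hy : ∀ g, xorSet y P h g u = y g u := by
    intro g
    unfold xorSet
    by_cases hg : g ∈ P
    · simp [hg, hu]
    · simp [hg]
  unfold ringWinU
  simp_rw [hy]

/-- **parity lemma (S-PRIME §10, end game by alignment):** if the number of cuts of `P` that are live at `u` is even, XOR-ing a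
common function into the registers of `P` does not change the win bit at `u` -/
theorem ringWinU_xorSet_of_even (c : ℕ) (y : Fin (n + 1) → (Fin n → Bool) → Bool) (P : Finset (Fin (n + 1)))
    (h : (Fin n → Bool) → Bool) (u : Fin n → Bool) (heven : (P.filter fun g => liveCut c u g = true).card % 2 = 0) :
    ringWinU c (xorSet y P h) u = ringWinU c y u := by
  classical
  by_cases hu : h u = false
  · exact ringWinU_xorSet_of_false c y P h u hu
  rw [Bool.not_eq_false] at hu
  -- the winning sets of the two strategies
  set W := univ.filter (fun g : Fin (n + 1) => y g u = true ∧ (c + g.val + walkExp u g.val) % 3 ≠ 0) with hW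
  set W' := univ.filter (fun g : Fin (n + 1) => xorSet y P h g u = true ∧ (c + g.val + walkExp u g.val) % 3 ≠ 0) with hW'
  set L := P.filter (fun g => liveCut c u g = true) with hL
  -- split both winning sets along membership in `P`
  have hsplit := card_filter_add_card_filter_not (s := W) (p := fun g => g ∈ P)
  have hsplit' := card_filter_add_card_filter_not (s := W') (p := fun g => g ∈ P)
  -- off `P` the two winning sets agree
  have hoff : W'.filter (fun g => ¬ g ∈ P) = W.filter (fun g => ¬ g ∈ P) := by
    ext g
    simp only [hW, hW', mem_filter, mem_univ, true_and]
    constructor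
    · rintro ⟨⟨hx, hl⟩, hg⟩
      exact ⟨⟨by rwa [xorSet_of_not_mem y h hg u] at hx, hl⟩, hg⟩
    · rintro ⟨⟨hx, hl⟩, hg⟩
      exact ⟨⟨by rwa [xorSet_of_not_mem y h hg u], hl⟩, hg⟩
  -- on `P` they are the two halves of the live part of `P`
  have hon : W.filter (fun g => g ∈ P) = L.filter (fun g => y g u = true) := by
    ext g
    simp only [hW, hL, mem_filter, mem_univ, true_and, liveCut, decide_eq_true_eq]
    constructor
    · rintro ⟨⟨hx, hl⟩, hg⟩
      exact ⟨⟨hg, hl⟩, hx⟩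
    · rintro ⟨⟨hg, hl⟩, hx⟩
      exact ⟨⟨hx, hl⟩, hg⟩
  have hon' : W'.filter (fun g => g ∈ P) = L.filter (fun g => ¬ y g u = true) := by
    ext g
    simp only [hW', hL, mem_filter, mem_univ, true_and, liveCut, decide_eq_true_eq]
    constructor
    · rintro ⟨⟨hx, hl⟩, hg⟩
      refine ⟨⟨hg, hl⟩, ?_⟩
      rw [xorSet_of_mem y h hg u, hu] at hx
      intro hy
      rw [hy] at hx
      exact absurd hx (by decide)
    · rintro ⟨⟨hg, hl⟩, hx⟩
      refine ⟨⟨?_, hl⟩, hg⟩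
      rw [xorSet_of_mem y h hg u, hu, Bool.eq_false_iff.mpr hx]
      decide
  have hLsplit := card_filter_add_card_filter_not (s := L) (p := fun g => y g u = true)
  rw [← hon, ← hon'] at hLsplit
  rw [hoff] at hsplit'
  have hpar : W'.card % 2 = W.card % 2 := by omega
  unfold ringWinU
  rw [← hW, ← hW', hpar]

/-- the parity lemma read as a transfer of wins: where the live count of `P` is even, the XOR-ed strategy wins iff the original one does -/
theorem ringWinU_xorSet_eq_true_iff (c : ℕ) (y : Fin (n + 1) → (Fin n → Bool) → Bool) (P : Finset (Fin (n + 1)))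
    (h : (Fin n → Bool) → Bool) (u : Fin n → Bool) (heven : (P.filter fun g => liveCut c u g = true).card % 2 = 0) :
    ringWinU c (xorSet y P h) u = true ↔ ringWinU c y u = true := by
  rw [ringWinU_xorSet_of_even c y P h u heven]

end Summit.QuantumAdvantage.QuantumAdvantage.Theorems.LivenessSeparation
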